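/-
Copyright: the b2b-balaban cell (near-miss cell 7), T⁴-continuum fan-out, NE7b ROUND-2 swarm `t4-ne7b-formalise-*`
(seat leaf-10, gen 4), supplier module for row S6g′-INSTANCE piece T3c «lattice-animal factor» in the PLACEMENT-VALUE
form of the instance seat's finding F-leaf05g3-2 (journal l.12296) of lineage t4-ne7b-p1's claim table `LEAVES-NE7b.md`.
Released under the licence of the surrounding project.
-/
import Summits.QuantumFields.BalabanUV.T4Continuum.Support.HistoryRegionTemplates

/-!
# Templates in the placement value: the finite TYPE `Template d M` and the animal factor `A(m)`

Summits-side support leaf of the T⁴-continuum cell (rung (B)+1 on a FINITE torus only; NOT infinite volume, NOT the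
mass gap, NOT the Clay statement; NOT a proof of the spine estimate NE7b).  Row S6g′-INSTANCE, piece T3c in the form
the instance seat's finding F-leaf05g3-2 asks for: the birth's region SHAPE rides in the PLACEMENT VALUE of the count
(`γ′ := TCell d (n·L^K) × Template d M`), so the template set must be a `Fintype`, and the witness-radius count picks
up, per non-host part, the factor **`A d M m = #{T : Template d M | #T ≤ m}`** with `m` tied linearly to the radius —
bounded here by `(2d+1)^{2m} = exp(2·log(2d+1)·m)` (class-linear downstream because the template size is tied to the
fatness by `TreeLength.card_le_treeLen`, `#Z ≤ 2^d(4·fat+1) = tcap d fat`).  [folklore] finite combinatorics on the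
swarm's OWN index model `Pt d = ℤ^d`, composed BY NAME with the sibling module `HistoryRegionTemplates`
(`finite_setOf_template`, `card_le_of_template` = the tree's animal count `LatticeAnimals.card_connectedFamily_le` at
Δ = 2d, `image_sub_mem_templates`, `faceConnected_image_add`); nothing is quoted from print, nothing printed is
asserted (B16 p. 384 «exp O(1)(MR_j)^{−d}|Z_j|» only LOCATED), no `[cite:]` tag, no `Prop` fact, constants SYMBOLIC
(trigger c6).

WHAT.
* §1 **`TemplatesN d M`** (finset of the face-connected `T ∋ 0` with `#T ≤ M`, raw-size keyed), **`Template d M`** (the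
  corresponding subtype) with `Fintype` ∕ `DecidableEq` instances, `zero_mem`, `faceConnected`, `card_le`,
  `one_le_card`, the one-cube template `Template.zero`.
* §2 **`A d M m`** and **`A_le : A d M m ≤ (2d+1)^(2m)`**, `one_le_A`, **`A_le_exp : A ≤ exp(2·log(2d+1)·m)`**, the
  real-radius reading **`A_floor_le_exp : A d M (⌊r⌋₊+1) ≤ exp(2·log(2d+1)·(r+1))`** (`0 ≤ r`), and the PRODUCT COUNT
  **`card_filter_prod_eq`** ∕ **`card_filter_prod_le`** ∕ `card_filter_prod_real_le`: `#{(y,T) | P y ∧ #T ≤ m} = #{y | P y} ·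
  A d M m` — the shape of F-leaf05g3-2 (3)'s `hNZ′ = hNZ · A(⌊r⌋₊+1)`.
* §3 translating a template to an anchor: **`translate T z = T.1.image (· + z)`** (`mem_translate_self`,
  `faceConnected_translate`, `card_translate`, `translate_injective`), and reading a REALISED region into the type:
  **`mkOfRegion`** (`z ∈ Z`, `FaceConnected Z`, `treeLen Z ≤ f`, `tcap d f ≤ M`) with **`val_mkOfRegion`**, the recovery
  **`image_add_mkOfRegion : (mkOfRegion …).1.image (· + z) = Z`** (= `translate_mkOfRegion`) and **`eq_of_mkOfRegion_eq`**
  (same anchor, same template ⇒ same region) — T3b's «history ↦ (anchor, region − anchor)» lands in `γ′` and forgets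
  nothing.  Names and shapes follow the instance seat's conventions (i)–(v) (journal l.12347).

HONEST DEPENDENCY (cell, verbatim): continuum YM on T⁴ ⇐ BetaPertH ∧ nine spine estimates (0/9 proved); BetaPertH ⇐
(D1) ∧ (D4) ∧ CAP+tail; G-an2-4 gates asym, D1 and NE2/3/4.  This file changes none of it; `BirthShapeNodup` is not
retired by it; NE7b NOT proved.
-/

open Finset
open Literature.MathematicalPhysics.QuantumFieldTheory.Balaban1983to89
open Literature.MathematicalPhysics.QuantumFieldTheory.Balaban1983to89.B13ScaleTransfer
open Literature.MathematicalPhysics.QuantumFieldTheory.Balaban1983to89.TreeLength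
open Summit.QuantumFields.BalabanUV.T4Continuum.HistoryRegionTemplates

namespace Summit.QuantumFields.BalabanUV.T4Continuum.HistoryJoinsTemplates

noncomputable section

variable {d M : ℕ}

/-! ## §1 Templates of bounded size: the finset and the type -/

/-- **THE TEMPLATES OF SIZE `≤ M`** (raw-size keyed): the face-connected `T ∋ 0` of ℤ^d with `#T ≤ M`, a finset by
`finite_setOf_template`. [folklore] -/
def TemplatesN (d M : ℕ) : Finset (Finset (Pt d)) := (finite_setOf_template d M).toFinset

/-- membership in `TemplatesN` [folklore] -/
theorem mem_templatesN_iff {T : Finset (Pt d)} :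
    T ∈ TemplatesN d M ↔ (0 : Pt d) ∈ T ∧ FaceConnected T ∧ T.card ≤ M := by
  rw [TemplatesN, Set.Finite.mem_toFinset]
  rfl

/-- `#(TemplatesN d M) ≤ (2d+1)^(2M)` [folklore] -/
theorem card_templatesN_le (d M : ℕ) : (TemplatesN d M).card ≤ (2 * d + 1) ^ (2 * M) :=
  card_le_of_template _ fun _ hT => mem_templatesN_iff.1 hT

/-- the fatness-keyed templates are the raw-size templates at the budget `tcap d f` [folklore] -/
theorem templates_eq_templatesN (d f : ℕ) : Templates d f = TemplatesN d (tcap d f) := by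
  ext T
  rw [mem_templates_iff, mem_templatesN_iff]

/-- **THE TYPE OF TEMPLATES OF SIZE `≤ M`** — the second component of the count's placement value
`γ′ = TCell × Template` (F-leaf05g3-2 (3)). [folklore] -/
abbrev Template (d M : ℕ) : Type := {T : Finset (Pt d) // (0 : Pt d) ∈ T ∧ FaceConnected T ∧ T.card ≤ M}

namespace Template

/-- templates form a finite type [folklore] -/
instance instFintype : Fintype (Template d M) :=
  Fintype.subtype (TemplatesN d M) fun _ => mem_templatesN_iff

/-- equality of templates is decidable [folklore] -/
instance instDecidableEq : DecidableEq (Template d M) :=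
  inferInstanceAs (DecidableEq {T : Finset (Pt d) // (0 : Pt d) ∈ T ∧ FaceConnected T ∧ T.card ≤ M})

/-- two templates with the same cubes are equal [folklore] -/
@[ext] theorem ext {T T' : Template d M} (h : T.1 = T'.1) : T = T' := Subtype.ext h

/-- the origin is a cube of every template [folklore] -/
theorem zero_mem (T : Template d M) : (0 : Pt d) ∈ T.1 := T.2.1

/-- templates are face-connected [folklore] -/
theorem faceConnected (T : Template d M) : FaceConnected T.1 := T.2.2.1

/-- templates have at most `M` cubes [folklore] -/
theorem card_le (T : Template d M) : T.1.card ≤ M := T.2.2.2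

/-- templates are non-empty [folklore] -/
theorem one_le_card (T : Template d M) : 1 ≤ T.1.card := card_pos.2 ⟨0, zero_mem T⟩

/-- **THE ONE-CUBE TEMPLATE** `{0}` (needs `1 ≤ M`). [folklore] -/
def zero (hM : 1 ≤ M) : Template d M :=
  ⟨{0}, mem_singleton_self _, fun x hx y hy => by
    rw [mem_singleton] at hx hy
    subst hx; subst hy
    exact Relation.ReflTransGen.refl, by simpa using hM⟩

/-- the cubes of the one-cube template [folklore] -/
@[simp] theorem val_zero (hM : 1 ≤ M) : (zero (d := d) hM).1 = {0} := rfl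

/-- `univ` of the template type, read back as finsets of cubes, is `TemplatesN` [folklore] -/
theorem image_val_univ (d M : ℕ) : (univ : Finset (Template d M)).image Subtype.val = TemplatesN d M := by
  ext T
  rw [mem_image, mem_templatesN_iff]
  constructor
  · rintro ⟨T', -, rfl⟩
    exact T'.2
  · intro h
    exact ⟨⟨T, h⟩, mem_univ _, rfl⟩

/-- the number of templates of size `≤ M` [folklore] -/
theorem card_univ (d M : ℕ) : Fintype.card (Template d M) = (TemplatesN d M).card := by
  rw [← image_val_univ, card_image_of_injective _ Subtype.val_injective, Finset.card_univ]

end Template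

/-! ## §2 The animal factor `A(m)` and the product count -/

/-- **THE ANIMAL FACTOR**: the number of templates (of the type `Template d M`) with at most `m` cubes. [folklore] -/
def A (d M m : ℕ) : ℕ := (univ.filter fun T : Template d M => T.1.card ≤ m).card

/-- **`A d M m ≤ (2d+1)^(2m)`** (the tree's animal count at Δ = 2d, raw-size keyed). [folklore] -/
theorem A_le (d M m : ℕ) : A d M m ≤ (2 * d + 1) ^ (2 * m) := by
  rw [A, ← card_image_of_injective _ (Subtype.val_injective : Function.Injective (Subtype.val : Template d M → _))]
  refine card_le_of_template _ fun Z hZ => ?_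
  obtain ⟨T, hT, rfl⟩ := mem_image.1 hZ
  exact ⟨T.2.1, T.2.2.1, (mem_filter.1 hT).2⟩

/-- `A` is monotone in the size cap `m` [folklore] -/
theorem A_mono (d M : ℕ) {m m' : ℕ} (h : m ≤ m') : A d M m ≤ A d M m' :=
  card_le_card fun _ hT => mem_filter.2 ⟨mem_univ _, (mem_filter.1 hT).2.trans h⟩

/-- `1 ≤ A` as soon as the one-cube template counts [folklore] -/
theorem one_le_A (hM : 1 ≤ M) {m : ℕ} (hm : 1 ≤ m) : 1 ≤ A d M m :=
  card_pos.2 ⟨Template.zero hM, mem_filter.2 ⟨mem_univ _, by simpa using hm⟩⟩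

/-- `A d M m ≤ #univ` [folklore] -/
theorem A_le_card_univ (d M m : ℕ) : A d M m ≤ Fintype.card (Template d M) := card_filter_le _ _

/-- **EXPONENTIAL FORM**: `A d M m ≤ exp(2·log(2d+1)·m)`. [folklore] -/
theorem A_le_exp (d M m : ℕ) : (A d M m : ℝ) ≤ Real.exp (2 * Real.log (2 * d + 1) * m) := by
  have h1 : (0 : ℝ) < 2 * d + 1 := by positivity
  have h : (A d M m : ℝ) ≤ ((2 * d + 1 : ℕ) : ℝ) ^ (2 * m) := by exact_mod_cast A_le d M m
  refine h.trans (le_of_eq ?_)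
  rw [← Real.exp_log (pow_pos (by exact_mod_cast h1) (2 * m)), Real.log_pow]
  push_cast
  ring_nf

/-- **THE REAL-RADIUS READING** (F-leaf05g3-2 (3): `near … (y,T) s r := nearD … ∧ #T ≤ r + 1`): for `0 ≤ r`,
`A d M (⌊r⌋₊ + 1) ≤ exp(2·log(2d+1)·(r+1))`. [folklore] -/
theorem A_floor_le_exp (d M : ℕ) {r : ℝ} (hr : 0 ≤ r) :
    (A d M (⌊r⌋₊ + 1) : ℝ) ≤ Real.exp (2 * Real.log (2 * d + 1) * (r + 1)) := by
  refine (A_le_exp d M _).trans (Real.exp_le_exp.2 ?_)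
  have hlog : 0 ≤ Real.log (2 * d + 1) := Real.log_nonneg (by norm_cast; omega)
  have hfl : ((⌊r⌋₊ + 1 : ℕ) : ℝ) ≤ r + 1 := by push_cast; linarith [Nat.floor_le hr]
  exact mul_le_mul_of_nonneg_left hfl (by positivity)

/-- a template with `#T ≤ r + 1` cubes (real `r ≥ 0`) has `#T ≤ ⌊r⌋₊ + 1` [folklore] -/
theorem card_le_floor_add_one {T : Template d M} {r : ℝ} (h : (T.1.card : ℝ) ≤ r + 1) :
    T.1.card ≤ ⌊r⌋₊ + 1 := by
  have h' : ((T.1.card - 1 : ℕ) : ℝ) ≤ r := by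
    have := Template.one_le_card T
    push_cast [this]
    linarith
  have := Nat.le_floor h'
  omega

section ProductCount

variable {β : Type*} [Fintype β] (P : β → Prop) [DecidablePred P]

/-- **THE PRODUCT COUNT** behind `hNZ′ = hNZ · A`: the placement values `(y, T)` with `P y` and `#T ≤ m` number exactly
`#{y | P y} · A d M m`. [folklore] -/
theorem card_filter_prod_eq (d M m : ℕ) :
    (univ.filter fun yT : β × Template d M => P yT.1 ∧ yT.2.1.card ≤ m).card = (univ.filter P).card * A d M m := by
  rw [A, ← card_product]
  congr 1
  ext q
  simp only [mem_filter, mem_univ, true_and, mem_product]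

/-- **THE PRODUCT COUNT, `≤` SPELLING** (the instance seat's convention (iii), journal l.12347). [folklore] -/
theorem card_filter_prod_le (d M m : ℕ) :
    (univ.filter fun yT : β × Template d M => P yT.1 ∧ yT.2.1.card ≤ m).card ≤ (univ.filter P).card * A d M m :=
  (card_filter_prod_eq P d M m).le

/-- … in the real-radius reading: `#{(y,T) | P y ∧ #T ≤ r + 1} ≤ #{y | P y} · A d M (⌊r⌋₊ + 1)`. [folklore] -/
theorem card_filter_prod_real_le (d M : ℕ) (r : ℝ) :
    (univ.filter fun yT : β × Template d M => P yT.1 ∧ (yT.2.1.card : ℝ) ≤ r + 1).card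
      ≤ (univ.filter P).card * A d M (⌊r⌋₊ + 1) := by
  rw [← card_filter_prod_eq]
  refine card_le_card fun q hq => ?_
  obtain ⟨hP, hc⟩ := (mem_filter.1 hq).2
  exact mem_filter.2 ⟨mem_univ _, hP, card_le_floor_add_one hc⟩

end ProductCount

/-! ## §3 Translating a template to an anchor; reading a realised region into the type -/

/-- **TRANSLATING A TEMPLATE TO AN ANCHOR**: `translate T z = T + z`. [folklore] -/
def translate (T : Template d M) (z : Pt d) : Finset (Pt d) := T.1.image (· + z)

/-- membership in a translated template [folklore] -/
theorem mem_translate {T : Template d M} {z x : Pt d} : x ∈ translate T z ↔ x - z ∈ T.1 := by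
  rw [translate, mem_image]
  constructor
  · rintro ⟨y, hy, rfl⟩
    simpa using hy
  · intro h
    exact ⟨x - z, h, sub_add_cancel x z⟩

/-- the anchor is a cube of the translated template [folklore] -/
theorem mem_translate_self (T : Template d M) (z : Pt d) : z ∈ translate T z :=
  mem_translate.2 (by simpa using Template.zero_mem T)

/-- a translated template is face-connected [folklore] -/
theorem faceConnected_translate (T : Template d M) (z : Pt d) : FaceConnected (translate T z) :=
  faceConnected_image_add (Template.faceConnected T) z

/-- translating preserves the number of cubes [folklore] -/
theorem card_translate (T : Template d M) (z : Pt d) : (translate T z).card = T.1.card :=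
  card_image_of_injective _ (add_left_injective z)

/-- a translated template has at most `M` cubes [folklore] -/
theorem card_translate_le (T : Template d M) (z : Pt d) : (translate T z).card ≤ M :=
  (card_translate T z).le.trans (Template.card_le T)

/-- the cubes of a template are read off any translate [folklore] -/
theorem mem_val_iff_add_mem_translate {T : Template d M} {z x : Pt d} : x ∈ T.1 ↔ x + z ∈ translate T z := by
  rw [mem_translate, add_sub_cancel_right]

/-- translating is injective in the template (fixed anchor) [folklore] -/
theorem translate_injective (z : Pt d) : Function.Injective fun T : Template d M => translate T z := by
  intro T T' h
  dsimp only at h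
  apply Template.ext
  ext x
  rw [mem_val_iff_add_mem_translate (z := z), mem_val_iff_add_mem_translate (z := z), h]

/-- **READING A REALISED REGION INTO THE TYPE**: `z ∈ Z`, `FaceConnected Z`, `treeLen Z ≤ f`, `tcap d f ≤ M` give the
template `Z − z : Template d M` (`HistoryZonesOrbitRealise.births_facts_of_corr` supplies the first three). [folklore] -/
def mkOfRegion {Z : Finset (Pt d)} {z : Pt d} (hz : z ∈ Z) (hc : FaceConnected Z) {f : ℕ} (hl : treeLen Z ≤ (f : ℝ))
    (hM : tcap d f ≤ M) : Template d M :=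
  ⟨Z.image (· - z),
    have h := mem_templates_iff.1 (image_sub_mem_templates hz hc hl)
    ⟨h.1, h.2.1, h.2.2.trans hM⟩⟩

/-- the cubes of the read template [folklore] -/
@[simp] theorem val_mkOfRegion {Z : Finset (Pt d)} {z : Pt d} (hz : z ∈ Z) (hc : FaceConnected Z) {f : ℕ}
    (hl : treeLen Z ≤ (f : ℝ)) (hM : tcap d f ≤ M) : (mkOfRegion hz hc hl hM).1 = Z.image (· - z) := rfl

/-- **RECOVERY**: translating the read template back to its anchor gives the region. [folklore] -/
theorem image_add_mkOfRegion {Z : Finset (Pt d)} {z : Pt d} (hz : z ∈ Z) (hc : FaceConnected Z) {f : ℕ}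
    (hl : treeLen Z ≤ (f : ℝ)) (hM : tcap d f ≤ M) : (mkOfRegion hz hc hl hM).1.image (· + z) = Z :=
  image_sub_image_add Z z

/-- recovery, `translate` spelling [folklore] -/
theorem translate_mkOfRegion {Z : Finset (Pt d)} {z : Pt d} (hz : z ∈ Z) (hc : FaceConnected Z) {f : ℕ}
    (hl : treeLen Z ≤ (f : ℝ)) (hM : tcap d f ≤ M) : translate (mkOfRegion hz hc hl hM) z = Z :=
  image_sub_image_add Z z

/-- the read template has as many cubes as the region [folklore] -/
theorem card_val_mkOfRegion {Z : Finset (Pt d)} {z : Pt d} (hz : z ∈ Z) (hc : FaceConnected Z) {f : ℕ}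
    (hl : treeLen Z ≤ (f : ℝ)) (hM : tcap d f ≤ M) : (mkOfRegion hz hc hl hM).1.card = Z.card := by
  rw [← card_translate (mkOfRegion hz hc hl hM) z, translate_mkOfRegion]

/-- the read template has at most `tcap d f` cubes (tied LINEARLY to the fatness) [folklore] -/
theorem card_val_mkOfRegion_le {Z : Finset (Pt d)} {z : Pt d} (hz : z ∈ Z) (hc : FaceConnected Z) {f : ℕ}
    (hl : treeLen Z ≤ (f : ℝ)) (hM : tcap d f ≤ M) : (mkOfRegion hz hc hl hM).1.card ≤ tcap d f := by
  rw [card_val_mkOfRegion]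
  exact card_le_tcap_of_treeLen ⟨z, hz⟩ hc hl

/-- **INJECTIVITY OF «region ↦ (anchor, template)»**: regions with the same anchor and the same read template are
equal. [folklore] -/
theorem eq_of_mkOfRegion_eq {Z Z' : Finset (Pt d)} {z : Pt d} (hz : z ∈ Z) (hc : FaceConnected Z) (hz' : z ∈ Z')
    (hc' : FaceConnected Z') {f f' : ℕ} (hl : treeLen Z ≤ (f : ℝ)) (hl' : treeLen Z' ≤ (f' : ℝ)) (hM : tcap d f ≤ M)
    (hM' : tcap d f' ≤ M) (h : mkOfRegion hz hc hl hM = mkOfRegion hz' hc' hl' hM') : Z = Z' := by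
  rw [← translate_mkOfRegion hz hc hl hM, ← translate_mkOfRegion hz' hc' hl' hM', h]

/-! ## §4 Sanity (decided ∕ definitional toy instances) -/

namespace Sanity

/-- the one-cube template placed at `(2, 5)` is `{(2, 5)}` -/
example : translate (Template.zero (d := 2) (M := 3) (by norm_num)) ![2, 5] = {![2, 5]} := by decide

end Sanity

end

end Summit.QuantumFields.BalabanUV.T4Continuum.HistoryJoinsTemplates
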